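import Literature.NumberTheory.LFunctions.RudnickSarnakCube
import HarnessLib

/-!
# The Fourier transform of the GUE determinant on a stratum: `∏_C ∑_{τ ∈ S*(C)} sign τ (1 - V_τ)`

Rudnick–Sarnak, Duke Math. J. **81** (1996), Proposition 4.3 / (4.27)–(4.30) and Lemma 4.3:
the density of `Ŵ_n` on the stratum `H_G` is the sum over the permutations `σ` with orbit
partition `G` of `sign σ ∏_{C ∈ G} (1 - V_{σ,C}(u))₊` (`RudnickSarnakCube.blockFactor`,
`cubeFunctional_eq_integral_extG`). On the support of an admissible `Φ`, `∑ |u_j| < 2`, so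
every spread `V ≤ ½ ∑_{C} |u_i| < 1` (`cycSpread_le_half_sum_abs`: the spread `max s_t - min s_t`
of the partial sums of a zero-sum sequence is at most half its `ℓ¹`-norm) and the positive parts
are not needed; the sum over `σ` then factors over the blocks (`sum_fib_eq_prod`, with the block
factor made local in `σ` via `localFactor`), and each block contributes the sum over the cyclic
permutations of `C` evaluated by `sum_cyc_sign_mul_one_sub_cycSpread` (Spitzer, (4.35)):

* `sum_sign_prod_blockFactor_eq_prod` : for `u ∈ H_G` with `∑ |u_j| < 2`,
  `∑_{σ ∈ fib G} sign σ ∏_C blockFactor σ u C = ∏_{C ∈ G} blockPoly G u C`,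
  `blockPoly G u C = μ_C + ∑_{∅ ≠ A ⊆ C ∖ {min C}} μ_A μ_{C∖A} |u(A)|`.

## References

* Z. Rudnick, P. Sarnak, Duke Math. J. 81 (1996), Lemma 4.3, Props. 4.2–4.3, (4.27)–(4.35).
-/

noncomputable section

open Finset Equiv Equiv.Perm
open Literature.Combinatorics.Enumerative Literature.Combinatorics.Enumerative.Spitzer

namespace Literature.NumberTheory.LFunctions

namespace RudnickSarnak

/-! ## The spread of a zero-sum sequence -/

section spreadBound

variable {ℓ : ℕ}

/-- Prefix sums as sums with indicators. [folklore] -/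
theorem preSum_eq_sum_ite (y : Fin ℓ → ℝ) (t : ℕ) :
    preSum y t = ∑ i : Fin ℓ, if (i : ℕ) < t then y i else 0 := by
  unfold preSum
  rw [Finset.sum_filter]

/-- For a zero-sum sequence, twice the difference of two prefix sums is at most the `ℓ¹`-norm:
the steps between the two times and the steps outside both bound the difference. [folklore] -/
theorem two_mul_preSum_sub_preSum_le (y : Fin ℓ → ℝ) (hy : ∑ i, y i = 0) (a b : ℕ) :
    2 * (preSum y a - preSum y b) ≤ ∑ i, |y i| := by
  set s : ℝ := if b ≤ a then 1 else -1 with hs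
  set d : Fin ℓ → ℝ := fun i ↦ (if (i : ℕ) < a then 1 else 0) - (if (i : ℕ) < b then 1 else 0) with hd
  have h1 : preSum y a - preSum y b = ∑ i, d i * y i := by
    rw [preSum_eq_sum_ite, preSum_eq_sum_ite, ← Finset.sum_sub_distrib]
    refine Finset.sum_congr rfl fun i _ ↦ ?_
    simp only [hd]
    split_ifs <;> ring
  have h2 : ∑ i, (2 * d i - s) * y i = 2 * (preSum y a - preSum y b) := by
    have : ∑ i, (2 * d i - s) * y i = 2 * ∑ i, d i * y i - s * ∑ i, y i := by
      rw [Finset.mul_sum, Finset.mul_sum, ← Finset.sum_sub_distrib]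
      exact Finset.sum_congr rfl fun i _ ↦ by ring
    rw [this, hy, mul_zero, sub_zero, h1]
  rw [← h2]
  refine Finset.sum_le_sum fun i _ ↦ ?_
  have hcoef : |2 * d i - s| ≤ 1 := by
    simp only [hd, hs]
    split_ifs <;> norm_num <;> omega
  calc (2 * d i - s) * y i ≤ |(2 * d i - s) * y i| := le_abs_self _
    _ = |2 * d i - s| * |y i| := abs_mul _ _
    _ ≤ 1 * |y i| := by gcongr
    _ = |y i| := one_mul _

/-- **The spread of a zero-sum sequence is at most half its `ℓ¹`-norm**:
`max_t s_t - min_t s_t ≤ ½ ∑ |y_i|`. [folklore] -/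
theorem spreadFn_le_half_sum_abs (y : Fin ℓ → ℝ) (hy : ∑ i, y i = 0) :
    spreadFn y ≤ (∑ i, |y i|) / 2 := by
  unfold spreadFn maxPre
  obtain ⟨a, -, ha⟩ := Finset.exists_mem_eq_sup' (⟨0, by simp⟩ : (range (ℓ + 1)).Nonempty) (preSum y)
  obtain ⟨b, -, hb⟩ := Finset.exists_mem_eq_sup' (⟨0, by simp⟩ : (range (ℓ + 1)).Nonempty) (preSum (-y))
  have hneg : preSum (-y) b = -preSum y b := by simp [preSum, Finset.sum_neg_distrib]
  rw [ha, hb, hneg]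
  have := two_mul_preSum_sub_preSum_le y hy a b
  linarith

end spreadBound

section cycBound

variable {α : Type*} [Fintype α] [DecidableEq α] {n : ℕ} {C : Finset α} (hC : #C = n + 1)
include hC

/-- **`V_τ(u) ≤ ½ ∑_{c ∈ C} |u_c|`** for a cyclic permutation `τ` of the block `C` and
`∑_C u = 0`. [cite: RudnickSarnak1996, Lemma 4.3] -/
theorem cycSpread_le_half_sum_abs {τ : Perm α} (hτ : τ ∈ fib {C}) {b : α} (hb : b ∈ C)
    (u : α → ℝ) (hu : ∑ c ∈ C, u c = 0) :
    cycSpread τ b (n + 1) u ≤ (∑ c ∈ C, |u c|) / 2 := by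
  unfold cycSpread
  have hsum := sum_comp_of_mem_linOrders hC (orbitSeq_mem_linOrders hC hτ hb) u
  have habs := sum_comp_of_mem_linOrders hC (orbitSeq_mem_linOrders hC hτ hb) (fun c ↦ |u c|)
  have h := spreadFn_le_half_sum_abs (u ∘ orbitSeq τ b (n + 1))
    (by simpa only [Function.comp_apply, hu] using hsum)
  simpa only [Function.comp_apply, habs] using h

end cycBound

/-! ## A local version of the block factor -/

section localSec

variable {n : ℕ}

/-- `σ` clamped to `C`: `σ` on `C`, the identity off `C`. [folklore] -/
def clamp (σ : Perm (Fin n)) (C : Finset (Fin n)) (x : Fin n) : Fin n := if x ∈ C then σ x else x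

/-- The iterates of `a` under the clamped map. [folklore] -/
def localSeq (σ : Perm (Fin n)) (C : Finset (Fin n)) (a : Fin n) (ℓ : ℕ) : Fin ℓ → Fin n :=
  fun t ↦ (clamp σ C)^[t.val] a

/-- The block factor computed from `σ|_C` only: `(1 - V)₊` with `V` the spread of `u` along the
clamped iterates of `min C`. [cite: RudnickSarnak1996, Lemma 4.3] -/
def localFactor (σ : Perm (Fin n)) (u : Fin n → ℝ) (C : Finset (Fin n)) : ℝ :=
  if h : C.Nonempty then max (1 - spreadFn (u ∘ localSeq σ C (C.min' h) #C)) 0 else 1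

/-- `localFactor` only depends on the values of `σ` on `C`. [folklore] -/
theorem localFactor_congr {σ σ' : Perm (Fin n)} {C : Finset (Fin n)} (h : ∀ x ∈ C, σ x = σ' x)
    (u : Fin n → ℝ) : localFactor σ u C = localFactor σ' u C := by
  have hcl : clamp σ C = clamp σ' C := by
    funext x
    unfold clamp
    split_ifs with hx
    · exact h x hx
    · rfl
  unfold localFactor localSeq
  rw [hcl]

/-- On a block preserved by `σ`, the clamped iterates of `a ∈ C` are the `σ`-iterates, i.e. the
orbit sequence read from `σ⁻¹ a`. [folklore] -/
theorem localSeq_eq_orbitSeq {σ : Perm (Fin n)} {C : Finset (Fin n)} (hσC : ∀ x ∈ C, σ x ∈ C)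
    {a : Fin n} (ha : a ∈ C) (ℓ : ℕ) : localSeq σ C a ℓ = orbitSeq σ (σ⁻¹ a) ℓ := by
  funext t
  simp only [localSeq, orbitSeq]
  rw [pow_succ, Perm.mul_apply, show σ (σ⁻¹ a) = a by simp]
  have key : ∀ m : ℕ, (clamp σ C)^[m] a = (σ ^ m) a ∧ (σ ^ m) a ∈ C := by
    intro m
    induction m with
    | zero => simpa using ha
    | succ m ih =>
      obtain ⟨h1, h2⟩ := ih
      rw [Function.iterate_succ_apply', h1, pow_succ', Perm.mul_apply, clamp, if_pos h2]
      exact ⟨rfl, hσC _ h2⟩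
  exact (key t.val).1

/-- For `σ` preserving the nonempty block `C`, the local factor is the block factor. [folklore] -/
theorem localFactor_eq_blockFactor {σ : Perm (Fin n)} {C : Finset (Fin n)} (hσC : ∀ x ∈ C, σ x ∈ C)
    (u : Fin n → ℝ) : localFactor σ u C = blockFactor σ u C := by
  unfold localFactor blockFactor
  split_ifs with h
  · rw [localSeq_eq_orbitSeq hσC (Finset.min'_mem C h), cycSpread]
  · rfl

end localSec

/-! ## The density of `Ŵ_n` on a stratum -/

section density

variable {n : ℕ} (G : Finpartition (univ : Finset (Fin n)))

/-- The block polynomial `μ_C + ∑_{∅ ≠ A ⊆ C ∖ {min C}} μ_A μ_{C∖A} |u(A)|` of a block `C` of `G`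
(the free part `C ∖ {min C}` written as the non-representatives of `C`).
[cite: RudnickSarnak1996, (4.24)–(4.26), (4.35)] -/
def blockPoly (u : Fin n → ℝ) (C : Finset (Fin n)) : ℝ :=
  (blockMoebius C : ℝ) + ∑ A ∈ (C.filter fun a ↦ ¬IsRep G a).powerset with A.Nonempty,
    ((blockMoebius A * blockMoebius (C \ A) : ℤ) : ℝ) * |∑ i ∈ A, u i|

/-- In a block `C` of `G`, the non-representatives are `C ∖ {min C}`. [folklore] -/
theorem filter_not_isRep_eq_erase {C : Finset (Fin n)} (hC : C ∈ G.parts) (h : C.Nonempty) :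
    (C.filter fun a ↦ ¬IsRep G a) = C.erase (C.min' h) := by
  have hrep : ∀ a ∈ C, rep G a = C.min' h := by
    intro a haC
    unfold rep
    congr 1
    exact G.part_eq_of_mem hC haC
  ext a
  simp only [Finset.mem_filter, Finset.mem_erase]
  constructor
  · rintro ⟨haC, hr⟩
    refine ⟨fun hm ↦ hr ?_, haC⟩
    show rep G a = a
    rw [hrep a haC, ← hm]
  · rintro ⟨hne, haC⟩
    refine ⟨haC, fun hr ↦ hne ?_⟩
    have hr' : rep G a = a := hr
    rw [hrep a haC] at hr'
    exact hr'.symm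

/-- **The sum over a block's cyclic permutations** of `sign τ · (1 - V_τ(u))₊`, for `u` summing
to zero on the block with `∑_C |u| < 2`, is the block polynomial.
[cite: RudnickSarnak1996, (4.35), Lemma 4.3] -/
theorem sum_cyc_sign_mul_blockFactor {C : Finset (Fin n)} (hC : C ∈ G.parts) (u : Fin n → ℝ)
    (hu0 : ∑ c ∈ C, u c = 0) (hu : ∑ c ∈ C, |u c| < 2) :
    ∑ τ ∈ fib {C}, ((Equiv.Perm.sign τ : ℤ) : ℝ) * blockFactor τ u C = blockPoly G u C := by
  have hne : C.Nonempty := G.nonempty_of_mem_parts hC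
  obtain ⟨k, hk⟩ : ∃ k, #C = k + 1 := ⟨#C - 1, (Nat.succ_pred_eq_of_pos (Finset.card_pos.2 hne)).symm⟩
  set m₀ := C.min' hne with hm₀
  have hm₀C : m₀ ∈ C := Finset.min'_mem C hne
  -- drop the positive parts and move the base point to `min C`
  have hbf : ∀ τ ∈ fib {C}, blockFactor τ u C = 1 - cycSpread τ m₀ (k + 1) u := by
    intro τ hτ
    unfold blockFactor
    rw [dif_pos hne, hk]
    have hb : τ⁻¹ m₀ ∈ C := IsCycleOn.apply_mem' (Equiv.Perm.isCycleOn_inv.2 (mem_cyc.1 hτ).1) hm₀C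
    rw [← hm₀, cycSpread_eq_of_mem hk hτ hm₀C hb u hu0]
    refine max_eq_left ?_
    have := cycSpread_le_half_sum_abs hk hτ hm₀C u hu0
    linarith
  rw [Finset.sum_congr rfl fun τ hτ ↦ by rw [hbf τ hτ], sum_cyc_sign_mul_one_sub_cycSpread hk hm₀C u hu0,
    blockPoly, filter_not_isRep_eq_erase G hC hne]

/-- **The density of `Ŵ_n` on the stratum `H_G`, factored over the blocks**: for `u ∈ H_G` with
`∑ |u_j| < 2`, `∑_{σ ∈ fib G} sign σ ∏_C (1 - V_{σ,C}(u))₊ = ∏_{C ∈ G} blockPoly G u C`.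
[cite: RudnickSarnak1996, Prop 4.3, (4.27)–(4.30), (4.35)] -/
theorem sum_sign_prod_blockFactor_eq_prod (u : Fin n → ℝ) (hH : ∀ a, ∑ i ∈ G.part a, u i = 0)
    (hu : ∑ j, |u j| < 2) :
    ∑ σ ∈ fib G.parts, ((Equiv.Perm.sign σ : ℤ) : ℝ) * ∏ C ∈ G.parts, blockFactor σ u C =
      ∏ C ∈ G.parts, blockPoly G u C := by
  -- replace the block factors by their local versions inside `fib G.parts`
  have h1 : ∀ σ ∈ fib G.parts, ∏ C ∈ G.parts, blockFactor σ u C = ∏ C ∈ G.parts, localFactor σ u C := by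
    intro σ hσ
    refine Finset.prod_congr rfl fun C hC ↦ (localFactor_eq_blockFactor (fun x hx ↦ ?_) u).symm
    exact IsCycleOn.apply_mem' ((mem_fib.1 hσ).1 C hC) hx
  rw [Finset.sum_congr rfl fun σ hσ ↦ by rw [h1 σ hσ],
    sum_fib_eq_prod G.parts G.disjoint (fun C σ ↦ localFactor σ u C)
      (fun C _ σ σ' h ↦ localFactor_congr h u)]
  refine Finset.prod_congr rfl fun C hC ↦ ?_
  rw [Finset.sum_congr rfl fun τ hτ ↦ by
    rw [localFactor_eq_blockFactor (fun x hx ↦ IsCycleOn.apply_mem' (mem_cyc.1 hτ).1 hx) u]]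
  obtain ⟨a, ha⟩ := G.nonempty_of_mem_parts hC
  have hCa : G.part a = C := G.part_eq_of_mem hC ha
  refine sum_cyc_sign_mul_blockFactor G hC u (hCa ▸ hH a) (lt_of_le_of_lt ?_ hu)
  exact Finset.sum_le_univ_sum_of_nonneg fun j ↦ abs_nonneg (u j)

end density

end RudnickSarnak

end Literature.NumberTheory.LFunctions

end
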